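import Summits.CriticalPhenomena.PercolationContinuityZ3.Theorems.PercNearOneGluingNoHeavyQuantFarSunTKFinalAllK
import Summits.CriticalPhenomena.PercolationContinuityZ3.Theorems.PercNearOneGluingNoHeavyQuantFarSunRow
import HarnessLib

/-!
# FAR beyond trees: the generic layer bookkeeping for `HairyCycle.SunFAR K j` — only the middle layers `2 ≤ j`, `2j < K` need certificates

builds on p205010 (kernel theorem, internal audit signed; external expert review pending)

Support file (`--supports stmt-CriticalPhenomena-4575`), seat `prim-cert-1` (gen 28); memo `prim-cert-1/FROM-prim-cert-1-g28-TOP-LAYERS.md`.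
For the sun graph with `K ≥ 2` hairs, `SunFAR K j` is automatic at layer `0` (the union bound `TwoCopy.FARp.zero`), at layer `1` (gen 23's closed-form
certificate `T_K`: `HairyCycle.sunFAR_one`, all `K`), and at every layer with `2j ≥ K` (at most `K ≤ 2j` relays can ever be reached, so the
hypothesis `2j < EN` is void: `TwoCopy.FARp.of_card_le`).  Hence the per-`K` assembly files (`…QuantFarSunRowLeEight`, `…LeNine`, …) only have to
supply the MIDDLE layers `2 ≤ j < K/2`; this file packages that reduction once:
* `HairyCycle.sunFAR_zero`, `HairyCycle.sunFAR_of_two_mul_ge` — the automatic layers;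
* **`HairyCycle.sunFAR_all_of_middle`** — `(∀ j, 2 ≤ j → 2j < K → SunFAR K j) → ∀ j, SunFAR K j`;
* `HairyCycle.farRelayRow_hairyCycle_of_middle` — the same reduction stated for `Quant.FarRelayRow`'s body on every hairy cycle with `K` pendant relays.
No sorries; standard axioms plus whatever the layer-one chain uses.  Elementary [this work].
-/

namespace Summit.CriticalPhenomena.PercolationContinuityZ3.Theorems.HairyCycle

open Finset MeasureTheory
open Literature.Probability.Percolation Literature.Probability.LatticeModels
open Summit.CriticalPhenomena.PercolationContinuityZ3.Theorems.TwoCopy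
open scoped Classical

/-- Layer `0` of `SunFAR` is the union bound (`TwoCopy.FARp.zero`). [this work] -/
theorem sunFAR_zero {K : ℕ} (hK : 2 ≤ K) : SunFAR K 0 :=
  sunFAR_of_farp_sun hK fun q _ => FARp.zero q _ _

/-- The vacuous layers: `SunFAR K j` whenever `K ≤ 2j` (at most `K` relays can be reached, so `2j < EN` never holds; `TwoCopy.FARp.of_card_le`).
[this work] -/
theorem sunFAR_of_two_mul_ge {K : ℕ} (hK : 2 ≤ K) {j : ℕ} (hj : K ≤ 2 * j) : SunFAR K j :=
  sunFAR_of_farp_sun hK fun q _ =>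
    FARp.of_card_le q _ _ j (Finset.card_image_le.trans (by rw [Finset.card_range]; omega))

/-- **All layers from the middle layers.**  If `SunFAR K j` holds for every `j` with `2 ≤ j` and `2j < K`, then it holds for every `j`:
layer `0` is `sunFAR_zero`, layer `1` is gen 23's `sunFAR_one` (all `K ≥ 2`), and `2j ≥ K` is `sunFAR_of_two_mul_ge`. [this work] -/
theorem sunFAR_all_of_middle {K : ℕ} (hK : 2 ≤ K) (h : ∀ j, 2 ≤ j → 2 * j < K → SunFAR K j) (j : ℕ) : SunFAR K j := by
  rcases Nat.lt_or_ge j 2 with hj | hj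
  · interval_cases j
    · exact sunFAR_zero hK
    · exact sunFAR_one hK
  · rcases Nat.lt_or_ge (2 * j) K with h2 | h2
    · exact h j hj h2
    · exact sunFAR_of_two_mul_ge hK h2

/-- **FAR (`Quant.FarRelayRow`'s body) at every layer on every hairy cycle with `K ≥ 2` pendant relays, from the middle-layer certificates
`SunFAR K j` (`2 ≤ j`, `2j < K`) alone.** [this work] -/
theorem farRelayRow_hairyCycle_of_middle {n L K : ℕ} {cyc : ℕ → Fin n} {base : ℕ → ℕ} {tip : ℕ → Fin n} (H : IsHairyCycle L cyc K base tip)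
    (hK : 2 ≤ K) (h : ∀ j, 2 ≤ j → 2 * j < K → SunFAR K j) (w : Sym2 (Fin n) → unitInterval)
    (hsupp : ∀ e : Sym2 (Fin n), ¬ e.IsDiag → w e ≠ 0 →
      (∃ i, i < L ∧ e = cycE L cyc i) ∨ (∃ k, k < K ∧ e = hairE cyc base tip k))
    (j : ℕ) (t : ℝ)
    (hEN : (2 * j : ℝ) < ∑ a ∈ (Finset.range K).image tip, (prodBernoulli w).real (openConn (cyc 0) a))
    (hcut : ∀ a ∈ (Finset.range K).image tip, (prodBernoulli w).real (openConn (cyc 0) a)ᶜ ≤ t) :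
    (prodBernoulli w).real {ω : BondConfig (Fin n) |
      (((Finset.range K).image tip).filter fun a => ω ∈ openConn (cyc 0) a).card ≤ j} ≤ t :=
  farRelayRow_hairyCycle_of_forall_sunFAR H (sunFAR_all_of_middle hK h) w hsupp j t hEN hcut

end Summit.CriticalPhenomena.PercolationContinuityZ3.Theorems.HairyCycle
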